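import Literature.AlgebraicGeometry.Modules.SerreTwistModExact
import Literature.AlgebraicGeometry.Modules.ProjectiveFamilyTwistPushforward
import Literature.AlgebraicGeometry.Modules.PullbackClosedImmersionIdealMul
import Literature.AlgebraicGeometry.Modules.IdealMulMaps
import Literature.AlgebraicGeometry.Modules.SheafHomLeft
import Literature.AlgebraicGeometry.Modules.EpiOfFibrewiseSurjective
import Literature.AlgebraicGeometry.Modules.FiniteType
import Literature.AlgebraicGeometry.Morphisms.FormalModuleSerreA
import HarnessLib

/-!
# Large twists restrict onto a closed subscheme: `Γ(Z, 𝒪_Z(m)) ↠ Γ(Z_Y, 𝒪_Z(m)|_{Z_Y})` with kernel `J·Γ(Z, 𝒪_Z(m))`, `m ≫ 0`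

Layer `Literature/AlgebraicGeometry/Modules` (0 definitions, 0 named facts, no instances, no notation). Let `A` be a
Noetherian ring, `ι : Z ⟶ 𝐏ʳ_A` a closed immersion (structure map `strZ ι : Z ⟶ Spec A`), `𝒪_Z(m) =
SerreTwist.twistMod ι (unitModule Z) m` the Serre twists (`Modules/SerreTwistMod`; rank-one locally free,
`Modules/ProjectiveFamilyTwistPushforward`), and `k : Z_Y ⟶ Z` a CLOSED IMMERSION with ideal sheaf `𝓘 = k.ker`
(typically `Z_Y = Z ×_{Spec A} Spec (A⧸J)`, the base change of `Z` along a closed immersion of the base). This file is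
the `H⁰`-form of Mumford's «stable» base change (*Curves on an algebraic surface*, Lect. 7 3° (i): for any `T → S`
there is `m₀` with `g^* p_*(𝓕(m)) ⥲ q_* h^*(𝓕(m))` for `m ≥ m₀`) for a closed immersion of the base and `𝓕 = 𝒪_Z`,
proved on the ideal-sheaf road (no graded modules):

* §1 **`app_top_surjective_of_shortExact_of_subsingleton_cechMH1`** (generic): for a short exact
  `0 → M' → M → M'' → 0` of `𝒪_X`-modules on an `A`-scheme with `M'` affine-localizing and `Ȟ¹(𝒰; M') = 0` on an affine
  open cover, `Γ(X, M) → Γ(X, M'')` is onto (the low-degree Čech sequence, `Morphisms/CechModuleExact(H0)`);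
* §2 **`exists_forall_pullbackUnit_app_top_surjective`**: there is `m₁` with `Γ(Z, 𝒪_Z(m)) → Γ(Z_Y, k^*𝒪_Z(m))` onto
  for all `m ≥ m₁` — from `0 → 𝓘·𝒪_Z(m) → 𝒪_Z(m) → k_*k^*𝒪_Z(m) → 0` (`Modules/PullbackClosedImmersionIdealMul`),
  `𝓘·𝒪_Z(m) ≅ (𝓘𝒪_Z)(m)` (`Modules/SerreTwistModExact`) and Serre's vanishing theorem for the coherent `𝓘𝒪_Z`
  (`Modules/SerreVanishingTwist`, `Modules/SerreTheoremA`);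
* §3 **`exists_forall_pullbackUnit_app_top_eq_zero_iff`**: if `𝓘` is generated by the image of an ideal `J ⊆ A`
  (`k.ker = ofIdealTop (J·Γ(Z, 𝒪_Z))`, e.g. `Z_Y = Z ×_A A⧸J`), there is `m₂` with
  `ker (Γ(Z, 𝒪_Z(m)) → Γ(Z_Y, k^*𝒪_Z(m))) = J·Γ(Z, 𝒪_Z(m))` for all `m ≥ m₂` — the epimorphism `⨁_{i} 𝒪_Z ↠ 𝓘𝒪_Z`
  given by generators of `J`, its coherent kernel `K`, exactness of twisting (`K(m) ↪ ⨁ 𝒪_Z(m) ↠ (𝓘𝒪_Z)(m)`) and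
  Serre vanishing for `K`;
* §4 **`exists_forall_surjective_and_ker_eq`** — both together: for `m ≥ m₀`, `Γ(Z, 𝒪_Z(m)) ⧸ J·Γ(Z, 𝒪_Z(m)) ⥲
  Γ(Z_Y, k^*𝒪_Z(m))`, i.e. `Γ(Z, 𝒪_Z(m)) ⊗_A A⧸J = Γ(Z_{A⧸J}, 𝒪_{Z_{A⧸J}}(m))` (EGA III 2.2 / Hartshorne III Ex. 5.10 road).

The sheaf-level statement `g^*((p_Z)_*𝒪_Z(m)) ⥲ (p_{Z_Y})_*(k^*𝒪_Z(m))` (`IsIso` of the base-change morphism) is the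
sequel `Modules/TwistPushforwardClosedBaseChangeIso`. Written for the cell `hodgecm-mathlib` (D-0151), F-DAG F-5 §3
(β′) (Mumford Lect. 8 3° (i) «3° (i) applied to the inclusion `Yᵢ ⊂ S`» for the flat strata of a non-flat projective
family); count-neutral capital; HC_CM is proved only modulo the 7 printed citations until rung 0 closes; nothing here
is about HC.

## References

* D. Mumford, *Lectures on Curves on an Algebraic Surface*, Annals of Math. Studies 59 (1966), Lecture 7, 3° (i)
  (pp. 51–52) and Lecture 8, 3° (i) (pp. 58–59). [Mumford1966CurvesSurface]
* R. Hartshorne, *Algebraic Geometry*, GTM 52 (1977), III Thm. 5.2 (p. 228) (Serre vanishing), III proof of Thm. 4.5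
  (p. 222) (long exact Čech sequence), II Prop. 5.9 (p. 116), III Ex. 5.10 (p. 231). [Hartshorne1977]
* The Stacks Project, Tag 08KS (Modules, Lemma 17.13.4: `i_*i^*𝓕 = 𝓕/𝓘𝓕`), Tag 01CL. [StacksProject]
-/

noncomputable section

-- `TopCat.Presheaf`/`Scheme.Modules` are not reducible (as in Mathlib's `AlgebraicGeometry/Modules`).
set_option backward.isDefEq.respectTransparency false

universe u v

open CategoryTheory CategoryTheory.Limits AlgebraicGeometry TopologicalSpace Opposite
open Literature.Algebra.Homology Literature.Algebra.Homology.LaurentCech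
open Literature.AlgebraicGeometry.Morphisms Literature.AlgebraicGeometry.Morphisms.ProjCech
open Literature.AlgebraicGeometry.Motives

namespace Literature.AlgebraicGeometry.Modules

/-! ## §1 Global sections of a short exact sequence with `Ȟ¹(M') = 0` -/

/-- **`Γ(X, M) → Γ(X, M'')` is onto when `Ȟ¹(𝒰; M') = 0`.** For an `A`-scheme `f : X → Spec A`, an affine open
cover `𝒰 = (U_i)` of `X` and a short exact `0 → M' → M → M'' → 0` with `M'` affine-localizing: every global section of
`M''` is a Čech `0`-cocycle whose obstruction `δ b'' ∈ Ȟ¹(𝒰; M')` to lifting vanishes. [cite: Hartshorne1977, III proof of Thm. 4.5 (p. 222)] -/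
theorem app_top_surjective_of_shortExact_of_subsingleton_cechMH1 {A : Type u} [CommRing A] {X : Scheme.{u}}
    (f : X ⟶ Spec (.of A)) {κ : Type v} (U : κ → X.Opens) (hUaff : ∀ i, IsAffineOpen (U i)) (hUcov : ⨆ i, U i = ⊤)
    {S : ShortComplex X.Modules} (hS : S.ShortExact) (h₁ : IsAffineLocalizing S.X₁)
    (hH1 : Subsingleton (CechMH1 f S.X₁ U)) : Function.Surjective (S.g.app ⊤) := by
  have hdata : CechExactData f U S.f S.g := CechExactData.of_shortExact f U hS h₁ hUaff
  intro t
  let b'' : cechMH0 f S.X₃ U := cechMH0EquivSections f U S.X₃ hUcov (show MSections f S.X₃ ⊤ from t)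
  have hδ : hdata.cechDelta b'' = 0 := Subsingleton.elim _ _
  obtain ⟨b, hb⟩ := hdata.exists_cechMapH0_eq_of_cechDelta_eq_zero b'' hδ
  refine ⟨(cechMH0EquivSections f U S.X₂ hUcov).symm b, ?_⟩
  change MSections.app f S.g ⊤ ((cechMH0EquivSections f U S.X₂ hUcov).symm b) = (t : MSections f S.X₃ ⊤)
  have hnat : (cechMH0EquivSections f U S.X₃ hUcov).symm (cechMapH0 f S.g U b) =
      MSections.app f S.g ⊤ ((cechMH0EquivSections f U S.X₂ hUcov).symm b) := by
    apply (cechMH0EquivSections f U S.X₃ hUcov).injective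
    rw [LinearEquiv.apply_symm_apply]
    apply Subtype.ext
    funext i
    rw [cechMapH0_coe, cechMapC0_apply]
    conv_lhs => rw [← (cechMH0EquivSections f U S.X₂ hUcov).apply_symm_apply b]
    change MSections.app f S.g (U i) (MSections.res f S.X₂ le_top _) = MSections.res f S.X₃ le_top _
    rw [MSections.res_app]
  rw [← hnat, hb]
  exact (cechMH0EquivSections f U S.X₃ hUcov).symm_apply_apply _

namespace SerreTwist

variable {A : Type u} [CommRing A] [IsNoetherianRing A] {r : ℕ} {Z : Scheme.{u}} (ι : Z ⟶ PP A r)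
  [IsClosedImmersion ι] {ZY : Scheme.{u}} (k : ZY ⟶ Z) [IsClosedImmersion k]

/-! ## §2 `Γ(Z, 𝒪_Z(m)) → Γ(Z_Y, k^*𝒪_Z(m))` is onto for `m ≫ 0` -/

/-- **Serre vanishing for `𝓘·𝒪_Z(m)`**: there is `m₁` with `Ȟ¹(𝒰; 𝓘·𝒪_Z(m)) = 0` on the standard affine cover for
all `m ≥ m₁` (`𝓘·𝒪_Z(m) ≅ (𝓘𝒪_Z)(m)` and `𝓘𝒪_Z` is coherent). [cite: Hartshorne1977, III Thm. 5.2 (p. 228)] -/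
theorem exists_forall_subsingleton_cechMH1_idealMul_twistMod (J : Z.IdealSheafData) :
    ∃ m₁ : ℕ, ∀ m : ℕ, m₁ ≤ m →
      Subsingleton (CechMH1 (strZ ι) (idealMul (twistMod ι (unitModule Z) m) J) (cover ι)) := by
  haveI := isLocallyNoetherian_of_isClosedImmersion_PP ι
  have hcoh : Coh (idealMul (unitModule Z) J) :=
    coh_idealMul J ⟨IsAffineLocalizing.unit, IsAffineFiniteType.unit⟩
  obtain ⟨mA, hA⟩ := exists_generators ι _ hcoh
  obtain ⟨N₀, g₀, hgen₀⟩ := hA mA le_rfl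
  obtain ⟨d₁, hd₁⟩ := exists_forall_subsingleton_cechMH1_twistMod ι _ mA g₀ hcoh.loc hgen₀
  refine ⟨d₁, fun m hm => ?_⟩
  obtain ⟨φ, -⟩ := exists_iso_twistMod_idealMul ι (unitModule Z) J m
  exact subsingleton_cechMH1_of_iso (strZ ι) (cover ι) φ.symm (hd₁ m hm)

/-- **The restriction of a large twist to a closed subscheme is onto on global sections**: there is `m₁` such that
`Γ(Z, 𝒪_Z(m)) → Γ(Z, k_*k^*𝒪_Z(m)) = Γ(Z_Y, k^*𝒪_Z(m))` is surjective for all `m ≥ m₁` — the short exact sequence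
`0 → 𝓘·𝒪_Z(m) → 𝒪_Z(m) → k_*k^*𝒪_Z(m) → 0` (`𝓘 = ker k`, `𝒪_Z(m)` locally free) and `Ȟ¹(𝓘·𝒪_Z(m)) = 0`.
[cite: Hartshorne1977, III Thm. 5.2 (p. 228)] [cite: StacksProject, Tag 08KS (Modules, Lemma 17.13.4)] -/
theorem exists_forall_pullbackUnit_app_top_surjective :
    ∃ m₁ : ℕ, ∀ m : ℕ, m₁ ≤ m →
      Function.Surjective ((pullbackUnit k (twistMod ι (unitModule Z) m)).app ⊤) := by
  obtain ⟨m₁, hm₁⟩ := exists_forall_subsingleton_cechMH1_idealMul_twistMod ι k.ker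
  refine ⟨m₁, fun m hm => ?_⟩
  have hF : IsFiniteLocallyFree (twistMod ι (unitModule Z) m) := isFiniteLocallyFree_twistMod_unitModule ι m
  have hS := shortExact_idealMulι_pullbackUnit k hF
  exact app_top_surjective_of_shortExact_of_subsingleton_cechMH1 (strZ ι) (cover ι)
    (fun i => isAffineOpen_Zop ι (Finset.singleton_nonempty i)) (iSup_cover_eq_top ι) hS
    (isAffineLocalizing_idealMul (J := k.ker) (isAffineLocalizing_twistMod_unitModule ι m)) (hm₁ m hm)

omit [IsNoetherianRing A] [IsClosedImmersion ι] [IsClosedImmersion k] in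
/-- Restriction from `⊤` to `⊤` is the identity. [folklore] -/
private theorem map_top_self (c : Γ(Z, ⊤)) : Z.presheaf.map (homOfLE (le_top : (⊤ : Z.Opens) ≤ ⊤)).op c = c := by
  rw [show (homOfLE (le_top : (⊤ : Z.Opens) ≤ ⊤)) = 𝟙 _ from Subsingleton.elim _ _, op_id,
    CategoryTheory.Functor.map_id]
  rfl

omit [IsNoetherianRing A] [IsClosedImmersion ι] [IsClosedImmersion k] in
/-- Sections of a finite sum of morphisms. [folklore] -/
private theorem sum_app_apply {M N : Z.Modules} {κ : Type*} (S : Finset κ) (f : κ → (M ⟶ N)) (U : Z.Opens)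
    (x : Γ(M, U)) : (∑ a ∈ S, f a).app U x = ∑ a ∈ S, (f a).app U x := by
  classical
  induction S using Finset.induction_on with
  | empty => rw [Finset.sum_empty, Finset.sum_empty, Scheme.Modules.Hom.zero_app]; rfl
  | insert a S ha ih => rw [Finset.sum_insert ha, Finset.sum_insert ha, Scheme.Modules.Hom.add_app, ← ih]; rfl

/-! ## §3 The kernel of `Γ(Z, 𝒪_Z(m)) → Γ(Z_Y, k^*𝒪_Z(m))` for `m ≫ 0` -/

/-- The twist `G(m)` of an affine-localizing module on the locally Noetherian `Z` is affine-localizing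
(`G(m) ≅ 𝓗om(𝒪_Z(-m), G)`, `Modules/SerreTwistHom`, `Modules/SheafHomCoh`). [cite: Hartshorne1977, II Prop. 5.12] -/
theorem isAffineLocalizing_twistMod {G : Z.Modules} (hG : IsAffineLocalizing G) (m : ℕ) :
    IsAffineLocalizing (twistMod ι G m) := by
  haveI := isLocallyNoetherian_of_isClosedImmersion_PP ι
  have hL : Coh (serreTwist ι m) := coh_of_isFiniteLocallyFree (HasRank.isFiniteLocallyFree' (hasRank_serreTwist ι m))
  exact IsAffineLocalizing.of_iso (sheafHomTwistIso ι G m) (isAffineLocalizing_sheafHom hL.loc hL.ft hG)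

/-- **An epimorphism of coherent modules is onto on GLOBAL sections after a large twist**: for `Ψ : P ↠ Q` with `P`,
`Q` coherent there is `m₂` with `Γ(Z, P(m)) → Γ(Z, Q(m))` surjective for all `m ≥ m₂` — twisting is exact
(`Modules/SerreTwistModExact`), so `0 → K(m) → P(m) → Q(m) → 0` with `K = ker Ψ` coherent, and `Ȟ¹(K(m)) = 0` for
`m ≫ 0` by Serre's vanishing theorem. [cite: Hartshorne1977, III Thm. 5.2 (p. 228)] -/
theorem exists_forall_twistModMap_app_top_surjective {P Q : Z.Modules} (Ψ : P ⟶ Q) [Epi Ψ] (hP : Coh P)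
    (hQ : Coh Q) : ∃ m₂ : ℕ, ∀ m : ℕ, m₂ ≤ m → Function.Surjective ((twistModMap ι Ψ m).app ⊤) := by
  haveI := isLocallyNoetherian_of_isClosedImmersion_PP ι
  have hK : Coh (kernel Ψ) := Coh.kernel Ψ hP hQ
  -- Serre vanishing for the kernel
  obtain ⟨mA, hA⟩ := exists_generators ι _ hK
  obtain ⟨N₀, g₀, hgen₀⟩ := hA mA le_rfl
  obtain ⟨d₁, hd₁⟩ := exists_forall_subsingleton_cechMH1_twistMod ι _ mA g₀ hK.loc hgen₀
  refine ⟨d₁, fun m hm => ?_⟩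
  have hS := shortExact_map_twistModFunctor ι (shortExact_kernel_of_epi Ψ) m
  exact app_top_surjective_of_shortExact_of_subsingleton_cechMH1 (strZ ι) (cover ι)
    (fun i => isAffineOpen_Zop ι (Finset.singleton_nonempty i)) (iSup_cover_eq_top ι) hS
    (isAffineLocalizing_twistMod ι hK.loc m) (hd₁ m hm)

omit [IsNoetherianRing A] [IsClosedImmersion ι] [IsClosedImmersion k] in
/-- Twisting commutes with multiplication by a global function: `(a·)(m) = a·` on `N(m)` (componentwise both are
multiplication by `a`). [cite: Hartshorne1977, II Prop. 5.12] -/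
theorem twistModMap_globalScalar (N : Z.Modules) (a : Γ(Z, ⊤)) (m : ℕ) :
    twistModMap ι (globalScalar N a) m = globalScalar (twistMod ι N m) a := by
  refine Scheme.Modules.hom_ext _ _ fun U => ?_
  ext n : 2
  refine twistMod_ext ι N fun j => ?_
  rw [comp_twistModMap_app, globalScalar_app_apply, globalScalar_app_apply, comp_smul]
  congr 1
  rw [← CategoryTheory.comp_apply, ← Functor.map_comp]
  rfl

omit [IsNoetherianRing A] [IsClosedImmersion ι] [IsClosedImmersion k] in
variable {ι k} in
/-- Under `k.ker = (J·𝒪_Z)~`, the global functions coming from `J` lie in `𝓘(V)` on every affine open `V`.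
[cite: StacksProject, Tag 01CL] -/
theorem map_appTop_mem_ker_ideal {J : Ideal Γ(Spec (.of A), ⊤)}
    (hker : k.ker = Scheme.IdealSheafData.ofIdealTop (J.map (strZ ι).appTop.hom)) {a : Γ(Spec (.of A), ⊤)}
    (ha : a ∈ J) (V : Z.affineOpens) :
    Z.presheaf.map (homOfLE (le_top : (V : Z.Opens) ≤ ⊤)).op ((strZ ι).appTop a) ∈ k.ker.ideal V := by
  rw [hker, Scheme.IdealSheafData.ofIdealTop_ideal]
  exact Ideal.mem_map_of_mem _ (Ideal.mem_map_of_mem _ ha)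

omit [IsNoetherianRing A] in
variable {ι k} in
/-- Under `k.ker = (J·𝒪_Z)~`, the global functions coming from `J` vanish on `Z_Y`: `k♯(p♯ a) = 0` for `a ∈ J` (checked
on the affine cover `k⁻¹(Z_j)`). [cite: StacksProject, Tag 01CL] -/
theorem appTop_appTop_eq_zero_of_mem {J : Ideal Γ(Spec (.of A), ⊤)}
    (hker : k.ker = Scheme.IdealSheafData.ofIdealTop (J.map (strZ ι).appTop.hom)) {a : Γ(Spec (.of A), ⊤)}
    (ha : a ∈ J) : k.appTop ((strZ ι).appTop a) = 0 := by
  set c := (strZ ι).appTop a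
  -- on each chart `Z_j`, `c|_{Z_j} ∈ 𝓘(Z_j) = ker k♯_{Z_j}`
  have hloc : ∀ j : Fin (r + 1), k.app (cover ι j) (Z.presheaf.map (homOfLE (le_top : cover ι j ≤ ⊤)).op c) = 0 := by
    intro j
    have hV : IsAffineOpen (cover ι j) := isAffineOpen_Zop ι (Finset.singleton_nonempty j)
    have hmem := map_appTop_mem_ker_ideal hker ha ⟨cover ι j, hV⟩
    rw [Scheme.Hom.ker_apply k ⟨cover ι j, hV⟩, RingHom.mem_ker] at hmem
    exact hmem
  -- glue: a section of `𝒪_{Z_Y}` vanishing on the cover `k⁻¹(Z_j)` vanishes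
  have hcov : (⊤ : ZY.Opens) ≤ ⨆ j : Fin (r + 1), k ⁻¹ᵁ cover ι j := by
    rw [← Scheme.Hom.preimage_iSup, iSup_cover_eq_top]
    exact le_of_eq (Scheme.Hom.preimage_top k).symm
  refine TopCat.Sheaf.eq_of_locally_eq' ZY.sheaf (fun j => k ⁻¹ᵁ cover ι j) ⊤ (fun j => homOfLE le_top) hcov
    (k.appTop c) 0 fun j => ?_
  rw [map_zero]
  have hnat := Scheme.Hom.naturality k (homOfLE (le_top : cover ι j ≤ ⊤)).op
  have h := congrArg (fun φ => φ.hom c) hnat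
  change k.app (cover ι j) (Z.presheaf.map _ c) = ZY.presheaf.map _ (k.appTop c) at h
  rw [hloc j] at h
  have e : (homOfLE (le_top : k ⁻¹ᵁ cover ι j ≤ ⊤)).op =
      ((Opens.map k.base).map (homOfLE (le_top : cover ι j ≤ ⊤)).op.unop).op := Subsingleton.elim _ _
  change ZY.presheaf.map (homOfLE (le_top : k ⁻¹ᵁ cover ι j ≤ ⊤)).op (k.appTop c) = 0
  rw [e]
  exact h.symm

/-- **The kernel of `Γ(Z, 𝒪_Z(m)) → Γ(Z_Y, k^*𝒪_Z(m))` is `J·Γ(Z, 𝒪_Z(m))` for `m ≫ 0`.** Suppose the ideal sheaf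
`𝓘 = ker k` of the closed immersion `k : Z_Y ↪ Z` is generated by the image of an ideal `J` of `Γ(Spec A)` (for instance
`Z_Y = Z ×_{Spec A} V(J)`). Then there is `m₂` such that for all `m ≥ m₂` a global section `t` of `𝒪_Z(m)` restricts to
`0` on `Z_Y` iff `t ∈ J·Γ(Z, 𝒪_Z(m))`: the sections killed by `η` are those of `𝓘·𝒪_Z(m) ≅ (𝓘𝒪_Z)(m)`
(`Modules/PullbackClosedImmersionIdealMul`, `Modules/SerreTwistModExact`), and the epimorphism `⨁_{a} 𝒪_Z ↠ 𝓘𝒪_Z`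
given by generators `a` of `J` is onto on global sections after a large twist. [cite: Mumford1966CurvesSurface, Lecture 7, 3° (i)]
[cite: Hartshorne1977, III Thm. 5.2 (p. 228)] [cite: StacksProject, Tag 08KS (Modules, Lemma 17.13.4)] -/
theorem exists_forall_pullbackUnit_app_top_eq_zero_iff (J : Ideal Γ(Spec (.of A), ⊤))
    (hker : k.ker = Scheme.IdealSheafData.ofIdealTop (J.map (strZ ι).appTop.hom)) :
    ∃ m₂ : ℕ, ∀ m : ℕ, m₂ ≤ m → ∀ t : Γ(twistMod ι (unitModule Z) m, ⊤),
      (pullbackUnit k (twistMod ι (unitModule Z) m)).app ⊤ t = 0 ↔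
        t ∈ J.map (strZ ι).appTop.hom • (⊤ : Submodule Γ(Z, ⊤) Γ(twistMod ι (unitModule Z) m, ⊤)) := by
  classical
  haveI := isLocallyNoetherian_of_isClosedImmersion_PP ι
  haveI : HasFiniteBiproducts Z.Modules := HasFiniteBiproducts.of_hasFiniteProducts
  -- generators of `J` (`Γ(Spec A) ≅ A` is Noetherian)
  haveI : IsNoetherianRing Γ(Spec (.of A), ⊤) :=
    isNoetherianRing_of_ringEquiv A (Scheme.ΓSpecIso (.of A)).symm.commRingCatIsoToRingEquiv
  obtain ⟨s, hs⟩ := (inferInstance : IsNoetherianRing Γ(Spec (.of A), ⊤)).noetherian J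
  have hmem : ∀ a : s, (a : Γ(Spec (.of A), ⊤)) ∈ J := fun a => hs ▸ Ideal.subset_span a.2
  -- the epimorphism `Ψ : ⨁_{a ∈ s} 𝒪_Z ↠ 𝓘𝒪_Z`, `Ψ_a = (p♯ a)·`
  have hgen : ∀ a : s, ∀ V : Z.affineOpens,
      Z.presheaf.map (homOfLE (le_top : (V : Z.Opens) ≤ ⊤)).op ((strZ ι).appTop a) ∈ k.ker.ideal V :=
    fun a V => map_appTop_mem_ker_ideal hker (hmem a) V
  let Ψ : (⨁ fun _ : s => unitModule Z) ⟶ idealMul (unitModule Z) k.ker :=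
    biproduct.desc fun a : s => globalScalarLift (unitModule Z) k.ker ((strZ ι).appTop (a : Γ(Spec (.of A), ⊤))) (hgen a)
  have hΨι : Ψ ≫ idealMulι (unitModule Z) k.ker =
      ∑ a : s, biproduct.π (fun _ : s => unitModule Z) a ≫ globalScalar (unitModule Z) ((strZ ι).appTop a) := by
    refine biproduct.hom_ext' _ _ fun a => ?_
    rw [biproduct.ι_desc_assoc, globalScalarLift_ι, Preadditive.comp_sum,
      Finset.sum_eq_single a (fun b _ hb => by rw [biproduct.ι_π_ne_assoc _ (Ne.symm hb), zero_comp])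
        (fun h => absurd (Finset.mem_univ a) h), biproduct.ι_π_self_assoc]
  -- `Ψ` is an epimorphism: on an affine `W`, `Γ(W, 𝓘𝒪_Z) = 𝓘(W)·Γ(W, 𝒪_Z)` and `𝓘(W)` is generated by the `p♯ a|_W`
  haveI hΨ : Epi Ψ := by
    refine epi_of_locallySurjective _ fun U t x hx => ?_
    obtain ⟨_, ⟨W, hW, rfl⟩, hxW, hWU⟩ := Z.isBasis_affineOpens.exists_subset_of_mem_open hx U.isOpen
    refine ⟨W, hWU, hxW, ?_⟩
    -- the range of `(Ψ ≫ ι)_W` contains `𝓘(W)·Γ(W, 𝒪_Z)`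
    set tW := (idealMul (unitModule Z) k.ker).presheaf.map (homOfLE hWU).op t
    have htW : (idealMulι (unitModule Z) k.ker).app W tW ∈
        k.ker.ideal ⟨W, hW⟩ • (⊤ : Submodule Γ(Z, W) Γ(unitModule Z, W)) :=
      idealMulι_app_mem (M := unitModule Z) (J := k.ker) IsAffineLocalizing.unit hW tW
    -- the `Γ(W, 𝒪_Z)`-submodule of sections in the range of `(Ψ ≫ ι)_W`
    let R : Submodule Γ(Z, W) Γ(unitModule Z, W) :=
      { carrier := {y | ∃ x, (Ψ ≫ idealMulι (unitModule Z) k.ker).app W x = y}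
        add_mem' := by
          rintro _ _ ⟨x, rfl⟩ ⟨x', rfl⟩
          exact ⟨x + x', map_add _ _ _⟩
        zero_mem' := ⟨0, map_zero _⟩
        smul_mem' := by
          rintro c _ ⟨x, rfl⟩
          exact ⟨c • x, Scheme.Modules.Hom.app_smul _ _ _⟩ }
    have hI : k.ker.ideal ⟨W, hW⟩ =
        Ideal.span (Set.range fun a : s => Z.presheaf.map (homOfLE (le_top : W ≤ ⊤)).op ((strZ ι).appTop a)) := by
      rw [hker, Scheme.IdealSheafData.ofIdealTop_ideal, ← hs, Ideal.map_span, Ideal.map_span, Set.image_image]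
      congr 1
      ext c
      simp only [Set.mem_image, Finset.mem_coe, Set.mem_range, Subtype.exists, exists_prop]
    have hle : k.ker.ideal ⟨W, hW⟩ • (⊤ : Submodule Γ(Z, W) Γ(unitModule Z, W)) ≤ R := by
      rw [Submodule.smul_le]
      intro c hc n _
      rw [hI] at hc
      refine Submodule.span_induction (p := fun c _ => c • n ∈ R) ?_ ?_ ?_ ?_ hc
      · rintro _ ⟨a, rfl⟩
        refine ⟨(biproduct.ι (fun _ : s => unitModule Z) a).app W n, ?_⟩
        change ((biproduct.ι (fun _ : s => unitModule Z) a ≫ Ψ) ≫ idealMulι (unitModule Z) k.ker).app W n = _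
        rw [biproduct.ι_desc, globalScalarLift_ι, globalScalar_app_apply]
      · rw [zero_smul]; exact R.zero_mem
      · intro c c' _ _ hc hc'
        rw [add_smul]; exact R.add_mem hc hc'
      · intro c c' _ hc'
        have h := R.smul_mem c hc'
        rw [smul_smul] at h
        exact h
    obtain ⟨x, hx⟩ := hle htW
    refine ⟨x, idealMulι_app_injective (unitModule Z) k.ker W ?_⟩
    rw [Scheme.Modules.Hom.comp_app, CategoryTheory.comp_apply] at hx
    exact hx
  -- coherence of source and target
  have hP : Coh (⨁ fun _ : s => unitModule Z) := by
    have e := (biproduct.isoCoproduct fun _ : s => unitModule Z).symm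
    have h0 : Coh (SheafOfModules.free (R := Z.ringCatSheaf) s) := coh_free (X := Z) s
    exact ⟨IsAffineLocalizing.of_iso e h0.loc, IsAffineFiniteType.of_iso e h0.ft⟩
  have hQ : Coh (idealMul (unitModule Z) k.ker) := coh_idealMul k.ker ⟨IsAffineLocalizing.unit, IsAffineFiniteType.unit⟩
  obtain ⟨m₂, hm₂⟩ := exists_forall_twistModMap_app_top_surjective ι Ψ hP hQ
  refine ⟨m₂, fun m hm t => ?_⟩
  have hF : IsFiniteLocallyFree (twistMod ι (unitModule Z) m) := isFiniteLocallyFree_twistMod_unitModule ι m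
  constructor
  · intro ht
    -- `t` is a section of `𝓘·𝒪_Z(m) ≅ (𝓘𝒪_Z)(m)`, hence in the image of `⨁ 𝒪_Z(m)`
    obtain ⟨t₁, ht₁⟩ := (sections_exact_of_shortExact (shortExact_idealMulι_pullbackUnit k hF) ⊤).2 t ht
    obtain ⟨φ, hφ⟩ := exists_iso_twistMod_idealMul ι (unitModule Z) k.ker m
    obtain ⟨u, hu⟩ := hm₂ m hm (φ.inv.app ⊤ t₁)
    have ht' : t = (twistModMap ι (Ψ ≫ idealMulι (unitModule Z) k.ker) m).app ⊤ u := by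
      rw [twistModMap_comp, ← hφ, Scheme.Modules.Hom.comp_app, CategoryTheory.comp_apply, hu]
      change t = ((φ.inv ≫ φ.hom ≫ idealMulι (twistMod ι (unitModule Z) m) k.ker).app ⊤) t₁
      rw [Iso.inv_hom_id_assoc]
      exact ht₁.symm
    have hterm : ∀ a : s, ((twistModFunctor ι m).map
        (biproduct.π (fun _ : s => unitModule Z) a ≫ globalScalar (unitModule Z) ((strZ ι).appTop a))).app ⊤ u ∈
          J.map (strZ ι).appTop.hom • (⊤ : Submodule Γ(Z, ⊤) Γ(twistMod ι (unitModule Z) m, ⊤)) := by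
      intro a
      change (twistModMap ι (_ ≫ _) m).app ⊤ u ∈ _
      rw [twistModMap_comp, twistModMap_globalScalar, Scheme.Modules.Hom.comp_app, CategoryTheory.comp_apply,
        globalScalar_app_apply, map_top_self]
      exact Submodule.smul_mem_smul (Ideal.mem_map_of_mem _ (hmem a)) Submodule.mem_top
    rw [ht', hΨι]
    change ((twistModFunctor ι m).map (∑ a : s, _)).app ⊤ u ∈ _
    rw [Functor.map_sum, sum_app_apply]
    exact Submodule.sum_mem _ fun a _ => hterm a
  · intro ht
    refine Submodule.smul_induction_on ht (fun c hc n _ => ?_) (fun x y hx hy => by rw [map_add, hx, hy, add_zero])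
    rw [Ideal.map] at hc
    refine Submodule.span_induction (p := fun c _ => (pullbackUnit k _).app ⊤ (c • n) = 0) ?_ ?_ ?_ ?_ hc
    · rintro _ ⟨a, ha, rfl⟩
      have h0 := globalScalar_comp_pullbackUnit k (appTop_appTop_eq_zero_of_mem hker ha) (twistMod ι (unitModule Z) m)
      have h1 : (pullbackUnit k (twistMod ι (unitModule Z) m)).app ⊤
          ((globalScalar (twistMod ι (unitModule Z) m) ((strZ ι).appTop a)).app ⊤ n) = 0 := by
        change ((globalScalar (twistMod ι (unitModule Z) m) ((strZ ι).appTop a) ≫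
          pullbackUnit k (twistMod ι (unitModule Z) m)).app ⊤) n = 0
        rw [h0, Scheme.Modules.Hom.zero_app]
        rfl
      rwa [globalScalar_app_apply, map_top_self] at h1
    · rw [zero_smul, map_zero]
    · intro c c' _ _ hc hc'
      rw [add_smul, map_add, hc, hc', add_zero]
    · intro c c' _ hc'
      change (pullbackUnit k _).app ⊤ ((c * c') • n) = 0
      rw [mul_smul, Scheme.Modules.Hom.app_smul, hc', smul_zero]

/-! ## §4 Both together -/

/-- **Mumford's stable base change along a closed immersion of the base, `H⁰`-form.** For `ι : Z ↪ 𝐏ʳ_A` closed over a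
Noetherian ring `A`, `k : Z_Y ↪ Z` a closed immersion whose ideal sheaf is generated by an ideal `J ⊆ Γ(Spec A)` (e.g.
`Z_Y = Z ×_{Spec A} V(J)`): there is `m₀` such that for every `m ≥ m₀` the restriction
`Γ(Z, 𝒪_Z(m)) → Γ(Z_Y, k^*𝒪_Z(m))` is SURJECTIVE with kernel `J·Γ(Z, 𝒪_Z(m))`, i.e.
`Γ(Z, 𝒪_Z(m)) ⊗_A A⧸J ⥲ Γ(Z_Y, 𝒪_Z(m)|_{Z_Y})`. [cite: Mumford1966CurvesSurface, Lecture 7, 3° (i)]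
[cite: Hartshorne1977, III Thm. 5.2 (p. 228)] -/
theorem exists_forall_pullbackUnit_app_top_surjective_and_eq_zero_iff (J : Ideal Γ(Spec (.of A), ⊤))
    (hker : k.ker = Scheme.IdealSheafData.ofIdealTop (J.map (strZ ι).appTop.hom)) :
    ∃ m₀ : ℕ, ∀ m : ℕ, m₀ ≤ m →
      Function.Surjective ((pullbackUnit k (twistMod ι (unitModule Z) m)).app ⊤) ∧
        ∀ t : Γ(twistMod ι (unitModule Z) m, ⊤),
          (pullbackUnit k (twistMod ι (unitModule Z) m)).app ⊤ t = 0 ↔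
            t ∈ J.map (strZ ι).appTop.hom • (⊤ : Submodule Γ(Z, ⊤) Γ(twistMod ι (unitModule Z) m, ⊤)) := by
  obtain ⟨m₁, hm₁⟩ := exists_forall_pullbackUnit_app_top_surjective ι k
  obtain ⟨m₂, hm₂⟩ := exists_forall_pullbackUnit_app_top_eq_zero_iff ι k J hker
  exact ⟨max m₁ m₂, fun m hm => ⟨hm₁ m ((le_max_left _ _).trans hm), hm₂ m ((le_max_right _ _).trans hm)⟩⟩

end SerreTwist

end Literature.AlgebraicGeometry.Modules

end
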